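import Summits.CriticalPhenomena.PercolationContinuityZ3.Theorems.Transplant.SkelFrmFromBChoiceAtQ
import Summits.CriticalPhenomena.PercolationContinuityZ3.Theorems.Transplant.PlanarSkeletonFrmFromProx
import HarnessLib

/-!
# GEN ROW (WAVE-Us-MANIFEST v1.0 §3/§9, INPUT layer) «SkelFrmFromBChoiceAtQPx» — the GENERALISED twin of «SkelFrmFromBChoiceAtQ» §3: the inputs of the
# choice function `choiceAtQ3` AT EVERY CENTRE under `HasProxies t D` in place of `types = {t}` (hunk class 'h1 ↦ proxy package', option (a))

builds on p205010 (kernel theorem, internal audit signed; external expert review pending) — nothing in this file uses p205010.  For each input lemma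
`…At_of_atQ hAt h1 c …` of the U twin, the `Px` twin `…At_of_atQPx hAt hP c …` concludes the SAME event shape AT `c` for the consumer-side data
`O.merged.toDataN.proxR hP.prox D` (seed `Λ (prox c)`, kit radius `+ D`; Us-1 modules 3–4), under the width floor `D ≤ n` for piece-links; the zone input is served
at the proxy (`Λ (prox c)` IS the consumer's zone family).  `D = 0`, `prox = id` recovers the U twin (`HasProxies.of_types_eq`, `prox_eq_self_of_zero`, `proxR_id`).
Nothing about any open node (U, U_s) is claimed.
[cite: KozmaNitzan2024, §4 pp. 19–21 ((21)–(25): the inputs at every vertex)] [this work]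
-/

noncomputable section

open scoped Classical

namespace Summit.CriticalPhenomena.PercolationContinuityZ3.Theorems.Transplant

open MeasureTheory Literature.Probability.Percolation Literature.Probability.LatticeModels SimpleGraph KNCells
open SkelConc (Consts)
open Skelφ (oriφ trφ)
open Skelφ.StepI (DataN DataNS OutNS famSign)

namespace PlanarSkeletonFrmFrom

namespace NegB

open Neg

section AtQPx

variable {κ : Consts} {V : Type} [DecidableEq V] [Countable V] {G : SimpleGraph V} [G.LocallyFinite] {Φ : PlanarSkeletonFrmFrom G} {t : V} {p : unitInterval}
  {hC : Φ.CylSubcritical p} {gv fv : Neg.FSlot} {Pv : PSlot} {Sv : SSlot} {cv : CSlot} {bv : BSlot} {O : OutNS V} {q : unitInterval} {D : ℕ}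

/-- **THE PIECE-LINKS OF ANY LISTED PAIR AT EVERY CENTRE `c` UNDER PROXIES** (consumer-side data `proxR`, width floor `D ≤ n`; served quadrant).
[cite: KozmaNitzan2024, §4 pp. 19–21] -/
theorem inputsPAt_of_atQPx (hAt : (choiceAtQ3 κ Φ t p Pv gv fv Sv cv bv hC).AtQNQ O q) (hP : Φ.HasProxies t D) (c : V) {M n : ℕ}
    (hMn : (M, n) ∈ SMnP κ Φ t p O.merged (gOf κ Φ t p O gv) (fOf κ Φ t p O fv) Pv) (hn : D ≤ n) (fam : Fin 2) (τ : ℤˣ) :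
    1 - δI3 κ Φ < (bondPercolation G q).real
      (Skelφ.StepI.eventNAt G (oriφ Φ.φ (O.ori t M n)) (O.merged.toDataN.proxR hP.prox D) t c
        (M, some (n, fam, Skelφ.StepI.sgQ O.qd O.qdT O.ori t M n fam, τ))) :=
  hP.inputsAt_proxR (choiceAtQ3 κ Φ t p Pv gv fv Sv cv bv hC) hAt c hMn hn fam τ

/-- **The extra pairs' piece-links at every centre under proxies** (`D ≤ n`). [this work] -/
theorem inputsExtraAt_of_atQPx (hAt : (choiceAtQ3 κ Φ t p Pv gv fv Sv cv bv hC).AtQNQ O q) (hP : Φ.HasProxies t D) (c : V) {M n : ℕ}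
    (hMn : (M, n) ∈ (Pv κ Φ t p O.merged).1) (hn : D ≤ n) (fam : Fin 2) (τ : ℤˣ) :
    1 - δI3 κ Φ < (bondPercolation G q).real
      (Skelφ.StepI.eventNAt G (oriφ Φ.φ (O.ori t M n)) (O.merged.toDataN.proxR hP.prox D) t c
        (M, some (n, fam, Skelφ.StepI.sgQ O.qd O.qdT O.ori t M n fam, τ))) :=
  inputsPAt_of_atQPx hAt hP c (extra_subset_SMnP κ Φ t p O.merged _ _ Pv hMn) hn fam τ

/-- **The short pair's piece-links at every centre under proxies, near sign `1`** (map `φS`; `D ≤ nS`). [cite: KozmaNitzan2024, §4 pp. 19–21] -/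
theorem inputsSAt_of_atQPx (hAt : (choiceAtQ3 κ Φ t p Pv gv fv Sv cv bv hC).AtQNQ O q) (hP : Φ.HasProxies t D) (c : V) (hn : D ≤ nS O.merged)
    (fam : Fin 2) (τ : ℤˣ) :
    1 - δI3 κ Φ < (bondPercolation G q).real
      (Skelφ.StepI.eventNAt G (φS t O.D O.DT.toDataN O.ori (Φ := Φ)) (O.merged.toDataN.proxR hP.prox D) t c
        (Mu O.merged, some (nS O.merged, fam, 1, τ))) := by
  have h := inputsPAt_of_atQPx hAt hP c
    (SMn_subset_SMnP κ Φ t p O.merged _ _ Pv (mem_SMn κ Φ t p O.merged (gOf κ Φ t p O gv) (fOf κ Φ t p O fv)).1) hn fam τ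
  have hsg : Skelφ.StepI.sgQ O.qd O.qdT O.ori t (Mu O.merged) (nS O.merged) fam = 1 := sgQ_sel_eq_one hAt _ _ fam
  rwa [hsg] at h

/-- **The long pair's piece-links at every centre under proxies, near sign `1`** (map `φL`; `D ≤ nL`). [cite: KozmaNitzan2024, §4 pp. 19–21] -/
theorem inputsLAt_of_atQPx (hAt : (choiceAtQ3 κ Φ t p Pv gv fv Sv cv bv hC).AtQNQ O q) (hP : Φ.HasProxies t D) (c : V)
    (hn : D ≤ nL κ Φ t p O.merged (gOf κ Φ t p O gv) (fOf κ Φ t p O fv)) (fam : Fin 2) (τ : ℤˣ) :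
    1 - δI3 κ Φ < (bondPercolation G q).real
      (Skelφ.StepI.eventNAt G (φL κ Φ t p O.D O.DT.toDataN O.ori (gOf κ Φ t p O gv) (fOf κ Φ t p O fv)) (O.merged.toDataN.proxR hP.prox D) t c
        (ML κ Φ t p O.merged (gOf κ Φ t p O gv), some (nL κ Φ t p O.merged (gOf κ Φ t p O gv) (fOf κ Φ t p O fv), fam, 1, τ))) := by
  have h := inputsPAt_of_atQPx hAt hP c
    (SMn_subset_SMnP κ Φ t p O.merged _ _ Pv (mem_SMn κ Φ t p O.merged (gOf κ Φ t p O gv) (fOf κ Φ t p O fv)).2) hn fam τ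
  have hsg : Skelφ.StepI.sgQ O.qd O.qdT O.ori t (ML κ Φ t p O.merged (gOf κ Φ t p O gv))
      (nL κ Φ t p O.merged (gOf κ Φ t p O gv) (fOf κ Φ t p O fv)) fam = 1 := by
    rw [(long_pair_eq κ Φ t p O.merged (gOf κ Φ t p O gv) (fOf κ Φ t p O fv)).1,
      (long_pair_eq κ Φ t p O.merged (gOf κ Φ t p O gv) (fOf κ Φ t p O fv)).2]
    exact sgQ_sel_eq_one hAt _ _ fam
  rwa [hsg] at h

/-- **The uniqueness zone at `M_u` AT THE PROXY of every centre** — the consumer's zone family is `Λ ∘ prox` (`(toDataN.proxR prox D).Λ c = Λ (prox c)`), so this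
is the consumer-shaped zone input at `c`. [this work] -/
theorem zoneAt_of_atQPx (hAt : (choiceAtQ3 κ Φ t p Pv gv fv Sv cv bv hC).AtQNQ O q) (hP : Φ.HasProxies t D) (c : V) :
    1 - δI3 κ Φ < (bondPercolation G q).real (UniqZone.zone G (O.merged.Λ (hP.prox c)) O.merged.k (Mu O.merged)) := by
  have h := hP.zoneAt_prox (choiceAtQ3 κ Φ t p Pv gv fv Sv cv bv hC) hAt c (Neg.Mu_mem_Sz O.merged)
  convert h using 4
  exact rfl

/-- **Every centre lies in its consumer-side seed** `Λ (prox c) k = (toDataN.proxR prox D).Λ c k` for `k ≥ D` (hunk (iii): the floor `max m₀ D`). [this work] -/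
theorem mem_seed_proxR_of_atQ (hAt : (choiceAtQ3 κ Φ t p Pv gv fv Sv cv bv hC).AtQNQ O q) (hP : Φ.HasProxies t D) (c : V) {k : ℕ} (hk : D ≤ k) :
    c ∈ (O.merged.toDataN.proxR hP.prox D).Λ c k := by
  obtain ⟨hfacts, -, -, -, -⟩ := hAt
  obtain ⟨-, -, -, -, hΛ, -⟩ := hfacts.1
  simp only [Skelφ.StepI.OutNS.toOutO_D] at hΛ
  rw [Skelφ.StepI.DataN.proxR_Λ]
  show c ∈ O.D.toDataN.Λ (hP.prox c) k
  rw [hΛ]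
  exact hP.mem_fatSeq_prox hC c hk

end AtQPx

end NegB

end PlanarSkeletonFrmFrom

end Summit.CriticalPhenomena.PercolationContinuityZ3.Theorems.Transplant

end
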